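import Literature.Geometry.Riemannian.SurgicalRicciFlow
import HarnessLib

/-!
# Chen–Zhu's Theorem 1.1 ⇒ Hamilton's Cor. 1.2(a): the case of no surgery, and the obstruction
# in the inductive step

Topological companion of `Literature/Geometry/Riemannian/SurgicalRicciFlow.lean`, which vends
**Chen–Zhu 2006, Thm. 1.1** (J. Differential Geom. 74; arXiv:math/0504478, p. 3) for simply
connected `M` as the named fact `chenZhu_ricciFlowWithSurgery`
(`∃ m, ChenZhuResolvableIn m M g₀`: the Ricci flow with `m` surgeries resolves `(M, g₀)` into a
finite union of iterated connected sums of Hamilton's pieces `S⁴`, `ℝℙ⁴`, `S³ × S¹`, `S³ ×~ S¹`)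
and leaves "the deduction of Hamilton's classification (`hamilton_pic_classification_four`,
hence `hamilton_chen_tang_zhu` / `hamilton_pic_sphere_four`) from it" to be proved in the tree —
Chen–Zhu's "As a direct consequence we have the following classification result of Hamilton",
Cor. 1.2 (p. 3). This file proves that deduction in the case `m = 0` (no surgery: the flow from
`g₀` simply becomes extinct) and records precisely what the inductive step `m + 1 ⇒ m` requires.

## Proved here (`m = 0`)

* `nonempty_diffeomorph_opens_of_coe_eq_univ` — an open submanifold whose carrier is all of `M`
  is diffeomorphic to `M` (the identity, re-typed).
* `IsUnionOfPieces.isConnectedSumOf` — a *connected* manifold which "is a finite union of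
  pieces" in the sense of Thm. 1.1 (iv) (`IsUnionOfPieces`: the component of every point is an
  open submanifold in the closure `IsConnectedSumOf 4 IsHamiltonPICPiece` of Hamilton's pieces
  under connected sums) lies itself in that closure (its unique component is all of `M`;
  transport along the diffeomorphism above, `isConnectedSumOf_isHamiltonPICPiece_of_diffeomorph`).
* `IsUnionOfPieces.nonempty_diffeomorph_sphere`, `ChenZhuResolvableIn.nonempty_diffeomorph_sphere_zero`
  — hence a *simply connected* closed 4-manifold resolved with **no** surgery is diffeomorphic
  to `S⁴`: the only simply connected piece is `S⁴` and `S⁴ # S⁴ ≅ S⁴`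
  (`IsConnectedSumOf.nonempty_diffeomorph_sphere_of_simplyConnectedSpace`, fed by the proved
  `connectedSum_sphere_sphere_holds`, Kervaire–Milnor 1963, Lemma 2.1). This is Cor. 1.2(a) for
  the manifolds on which the flow of Thm. 1.1 has `m = 0`.

## The inductive step, and why it is not proved from the vended structure alone

For `m + 1` surgeries, `ChenZhuResolvableIn (m+1) M g₀` provides the maximal flow `g` on `[0,T)`,
a closed `M'` with `IsSurgeryStep g T g₀'` and `ChenZhuResolvableIn m M' g₀'`. The surgery step
(Thm. 1.1 (i)–(iii), vended as `IsSurgeryStep`) records: compact regular domains `N ⊆ M`,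
`N' ⊆ M'`, a diffeomorphism `Φ` of open neighbourhoods with `Φ(N) = N'` (`AreIsometricDomains`),
the components of `M ∖ N` being collared necks `S³ × (0,1)`, collared balls, collared projective
caps or discarded closed pieces, and the components of `M' ∖ N'` being collared balls
(`PostsurgeryPieces`). To rebuild `M` from `M'` one removes the balls of `M' ∖ N'` and glues back,
along the boundary spheres `∂N ≅ ∂N'`, either balls (ball pieces of `M ∖ N`) or tubes
`S³ × [0,1]` (neck pieces; a neck joining two components is a connected sum, Kervaire–Milnor
1963, §2). The collars of the ball pieces of `M'` and of the pieces of `M` are matched by `Φ`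
only along `N`, i.e. up to an arbitrary self-diffeomorphism `f` of `S³` on each boundary sphere;
regluing a 4-ball along `f` changes the manifold by a connected sum with the *twisted sphere*
`Σ(f) = D⁴ ∪_f D⁴`, whose diffeomorphism type depends only on the pseudo-isotopy class of `f`
(Kervaire–Milnor 1963, §1). Hence from `IsSurgeryStep` as vended, `M` is determined by the
components of `M'` (and the discarded pieces) only **up to connected sums with twisted
4-spheres**, and the conclusion "`M ≅ S⁴`" of Cor. 1.2(a) needs in addition `Σ(f) ≅ S⁴` for every
`f ∈ Diff(S³)` — Cerf's theorem `Γ₄ = 0` (Cerf 1968), in the tree the named facts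
`Literature.Topology.FourManifolds.cerf_twistedSphere_four` /
`cerf_diffeomorph_sphere_three_extends_ball` (`CerfGammaFour.lean`, `CerfGammaFourProofs.lean`).
In the construction of Chen–Zhu §5 (p. 29: the new metric `g̃` on the four-ball is built in the
coordinate `z` of the `δ`-neck; p. 25: "`M⁴` is diffeomorphic to a connected sum of `Ω̄ⱼ` …") the
surgery caps are glued to `N` along the parametrisations of the `δ`-necks themselves, so that no
such ambiguity arises there; a vending of
Thm. 1.1 recording this compatibility (the ball pieces of `M' ∖ N'` and the neck pieces of `M ∖ N`
share their collar coordinates through `Φ`) would make the inductive step a statement about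
standard connected sums (`Literature.Topology.FourManifolds.IsConnectedSum`, `isConnectedSum_of_neck'`
of `NeckConnectedSum.lean`) provable without Cerf's theorem. Neither route is attempted in this
file.

## References

* B.-L. Chen, X.-P. Zhu, *Ricci flow with surgery on four-manifolds with positive isotropic
  curvature*, J. Differential Geom. 74 (2006) 177–264 (arXiv:math/0504478): Thm. 1.1, Cor. 1.2
  (p. 3), §5 (pp. 25, 29). [ChenZhu2006]
* R. S. Hamilton, *Four-manifolds with positive isotropic curvature*, Comm. Anal. Geom. 5 (1997),
  Thm. 1.1 (p. 2), Cor. 1.2 (p. 3). [Hamilton1997]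
* M. Kervaire, J. Milnor, *Groups of homotopy spheres I*, Ann. of Math. 77 (1963), §1 (twisted
  spheres), §2 (connected sum, Lemma 2.1). [KervaireMilnor1963]
* J. Cerf, *Sur les difféomorphismes de la sphère de dimension trois (Γ₄ = 0)*, LNM 53 (1968).
  [Cerf1968]
-/

noncomputable section

open Set Function TopologicalSpace
open scoped Manifold ContDiff Topology

namespace Literature.Geometry.Riemannian

open Lorentzian Literature.Topology.FourManifolds

/-! ### An open submanifold with carrier `univ` is the whole manifold -/

section Opens

variable {E : Type*} [NormedAddCommGroup E] [NormedSpace ℝ E] {H : Type*} [TopologicalSpace H]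
  {I : ModelWithCorners ℝ E H} {M : Type*} [TopologicalSpace M] [ChartedSpace H M]

/-- **An open submanifold whose carrier is all of `M` is diffeomorphic to `M`**: the bijection
`x ↦ ⟨x, _⟩` and its inverse `Subtype.val` are `C^∞` for Mathlib's open-submanifold structure
(`contMDiff_subtype_val`, `ContMDiff.subtypeVal_comp_iff`). [folklore] -/
theorem nonempty_diffeomorph_opens_of_coe_eq_univ (U : Opens M) (hU : (U : Set M) = univ) :
    Nonempty (M ≃ₘ⟮I, I⟯ U) :=
  ⟨{ toFun := fun x ↦ ⟨x, show x ∈ (U : Set M) from hU ▸ mem_univ x⟩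
     invFun := Subtype.val
     left_inv := fun _ ↦ rfl
     right_inv := fun _ ↦ Subtype.ext rfl
     contMDiff_toFun := (ContMDiff.subtypeVal_comp_iff U _).1 contMDiff_id
     contMDiff_invFun := contMDiff_subtype_val }⟩

end Opens

/-! ### A connected finite union of pieces is an iterated connected sum of pieces -/

variable {M : Type} [TopologicalSpace M] [ChartedSpace (EuclideanSpace ℝ (Fin 4)) M]

/-- **A connected "finite union of pieces" lies in the closure of Hamilton's pieces under
connected sums** (Chen–Zhu 2006, Thm. 1.1 (iv), for a connected `M_m`): the component of any
point is all of `M` (`PreconnectedSpace.connectedComponent_eq_univ`), so the open submanifold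
provided by `IsUnionOfPieces` has carrier `univ` and is diffeomorphic to `M`
(`nonempty_diffeomorph_opens_of_coe_eq_univ`); the closure is diffeomorphism invariant
(`isConnectedSumOf_isHamiltonPICPiece_of_diffeomorph`). [cite: ChenZhu2006, Thm. 1.1 (iv) (p. 3)] -/
theorem IsUnionOfPieces.isConnectedSumOf [IsManifold (𝓡 4) ∞ M] [ConnectedSpace M]
    (h : IsUnionOfPieces M) : IsConnectedSumOf 4 IsHamiltonPICPiece M := by
  obtain ⟨x⟩ := (inferInstance : Nonempty M)
  obtain ⟨C, hC, hsum⟩ := h.2 x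
  rw [PreconnectedSpace.connectedComponent_eq_univ] at hC
  obtain ⟨e⟩ := nonempty_diffeomorph_opens_of_coe_eq_univ (I := 𝓡 4) C hC
  exact isConnectedSumOf_isHamiltonPICPiece_of_diffeomorph hsum e.symm

/-- **A simply connected finite union of pieces is diffeomorphic to `S⁴`** (the passage from
Thm. 1.1 (iv) to Cor. 1.2(a) when no surgery occurs): a simply connected space is connected, so
`M` is an iterated connected sum of Hamilton's pieces (`IsUnionOfPieces.isConnectedSumOf`); its
summands are simply connected, the only simply connected piece is `S⁴`
(`IsHamiltonPICPiece.nonempty_diffeomorph_sphere_of_simplyConnectedSpace`: `π₁(ℝℙ⁴) = ℤ₂`,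
`π₁(S³ × S¹) = π₁(S³ ×~ S¹) = ℤ`), and `S⁴ # S⁴ ≅ S⁴` (Kervaire–Milnor 1963, Lemma 2.1, proved in
the tree): `IsConnectedSumOf.nonempty_diffeomorph_sphere_of_simplyConnectedSpace`.
[cite: ChenZhu2006, Cor. 1.2 (p. 3)] [cite: Hamilton1997, Cor. 1.2(a) (p. 3)] -/
theorem IsUnionOfPieces.nonempty_diffeomorph_sphere [IsManifold (𝓡 4) ∞ M]
    [SimplyConnectedSpace M] (h : IsUnionOfPieces M) :
    Nonempty (M ≃ₘ⟮𝓡 4, 𝓡 4⟯ Metric.sphere (0 : EuclideanSpace ℝ (Fin 5)) 1) :=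
  h.isConnectedSumOf.nonempty_diffeomorph_sphere_of_simplyConnectedSpace (by norm_num)
    fun _ _ _ hX hsc ↦ hX.nonempty_diffeomorph_sphere_of_simplyConnectedSpace hsc

/-- **Chen–Zhu's Thm. 1.1 with no surgery implies Cor. 1.2(a).** If the Ricci flow resolves the
closed simply connected 4-manifold `(M, g₀)` with `m = 0` surgeries (`ChenZhuResolvableIn 0 M g₀`:
the maximal flow from `g₀` exists and `M` is already a finite union of pieces, Thm. 1.1 (iv)),
then `M` is diffeomorphic to `S⁴`. The case `m ≥ 1` needs, from the structure vended as
`IsSurgeryStep`, Cerf's `Γ₄ = 0` in addition (see the module docstring).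
[cite: ChenZhu2006, Thm. 1.1 and Cor. 1.2 (p. 3)] [cite: Hamilton1997, Cor. 1.2(a) (p. 3)] -/
theorem ChenZhuResolvableIn.nonempty_diffeomorph_sphere_zero [T2Space M] [SecondCountableTopology M]
    [CompactSpace M] [IsManifold (𝓡 4) ∞ M] [SimplyConnectedSpace M]
    {g₀ : PseudoRiemannianMetric (𝓡 4) ∞ (EuclideanSpace ℝ (Fin 4)) (TangentSpace (𝓡 4) : M → Type _)}
    (h : ChenZhuResolvableIn 0 M g₀) :
    Nonempty (M ≃ₘ⟮𝓡 4, 𝓡 4⟯ Metric.sphere (0 : EuclideanSpace ℝ (Fin 5)) 1) := by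
  obtain ⟨-, -, -, -, -, hpieces⟩ := h
  exact hpieces.nonempty_diffeomorph_sphere

/-- The same conclusion in connected-sum form (the conclusion of
`hamilton_pic_connectedSum_spheres_four`, `PICSphereFactsProofs.lean`): a closed simply connected
4-manifold resolved with no surgery is a connected sum of copies of `S⁴`.
[cite: ChenZhu2006, Thm. 1.1 and Cor. 1.2 (p. 3)] -/
theorem ChenZhuResolvableIn.isConnectedSumOfSpheres_zero [T2Space M] [SecondCountableTopology M]
    [CompactSpace M] [IsManifold (𝓡 4) ∞ M] [SimplyConnectedSpace M]
    {g₀ : PseudoRiemannianMetric (𝓡 4) ∞ (EuclideanSpace ℝ (Fin 4)) (TangentSpace (𝓡 4) : M → Type _)}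
    (h : ChenZhuResolvableIn 0 M g₀) : IsConnectedSumOfSpheres 4 M :=
  .sphere h.nonempty_diffeomorph_sphere_zero.some

end Literature.Geometry.Riemannian

end
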